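import Summits.BirchSwinnertonDyer.BirchSwinnertonDyer.Theorems.EisensteinDepletionAtTwoStarEisEightGlobal
import Summits.BirchSwinnertonDyer.BirchSwinnertonDyer.Theorems.EisensteinDepletionAtTwoStarEisOddWitness
import Literature.NumberTheory.ModularForms.DedekindEtaLogTransformation
import Summits.BirchSwinnertonDyer.BirchSwinnertonDyer.Theorems.EisensteinDepletionAtTwoStarGO2CuspEvennessCore
import HarnessLib

/-!
# Route `EisensteinDepletionAtTwo`, crux `StarGO2Sigma` (stmt-BirchSwinnertonDyer-27046), line `kummer` v7 —
# K2a `stub_etaSignCharacter` (THEOREM B(i), the η SIGN CHARACTER) FROM DEDEKIND'S `log η` LAW + TREE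

planner bsd-rank2-p2 GEN 38, PART 12 (evidence for 27046; the lead lands it `--supports 27046`).

THE CLAIM (K2a of HOME/p2/g38/KUMMER-V7-DESIGN.md): for `N` odd, `β` admissible, `r_t = N c_t` and a generator `g'` of the value group
`φ_β(Γ₀(N)) = ℤ g'` there are an odd `s` and a holomorphic `v` on `ℍ` with `v² = g̃^s`, `g̃ = ∏ η(tτ)^{r_t}`, and
`v(γτ) = (−1)^{φ_β(γ)/g'} v(τ)` on `Γ₀(N)`.

PROOF (this file, sorry-free GIVEN the named print fact `dedekindEta_logTransformationLaw` = [RademacherGrosswald1972, Ch. 4 A, eq. (60)]):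
* ARITHMETIC (tree only): `N·φ_β(γ) ∈ 8ℤ` for every `γ ∈ Γ₀(N)` — for `c > 0` this is the log-period integrality
  `etaQuotient_logPeriod_mem_int` of the Newman quotient `g_β = g̃³` (`exists_exponentVector`, `isSquare_prod_pow_natAbs`), for `c < 0`
  by `Φ(−M) = Φ(M)`, for `c = 0` by `Σ c_t t = 0`; and `N g' = 8 M₀` with `M₀` ODD, because a difference of two cusp values has
  2-adic norm exactly `8⁻¹` (`exists_inC_norm_stabEisCuspDiff_eq`).
* ANALYTIC: `s = 3`, `v = exp((3/2)·Σ_t r_t log η(tτ))`; Dedekind's law summed over `t ∣ N` (`Σ r_t = 0` kills the `log(cτ+d)` term,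
  `Σ t r_t = 0` the translation term) gives `v(γτ) = exp(πi N φ_β(γ)/8) v(τ) = (−1)^{M₀ n} v(τ) = (−1)^n v(τ)` for `φ_β(γ) = n g'`.

HONEST FRAMING: no elliptic curve; the only non-tree input is Dedekind's 1877 transformation law of `log η` at LOG level (the tree
has the exponentiated law `eta_SL2_smul_rademacherPhi`, which cannot see the sign).  [cite: RademacherGrosswald1972, Ch. 4 A,
eq. (57a), (60)] [cite: Stevens1982, §2.4–2.5]
-/

set_option autoImplicit false
set_option linter.dupNamespace false

noncomputable section

namespace Summit.BirchSwinnertonDyer.BirchSwinnertonDyer.Theorems.DepletionAtTwo.KEta.EtaSign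

open Literature.NumberTheory.ModularForms Literature.NumberTheory.EllipticCurves
  Literature.NumberTheory.EllipticCurves.ModularForms
open scoped MatrixGroups CongruenceSubgroup Manifold
open CongruenceSubgroup UpperHalfPlane

variable {N : ℕ} {β : ℕ → ℕ}

/-! ## §1 Arithmetic: `N φ_β(Γ₀(N)) ⊆ 8ℤ` and `N g' = 8 M₀`, `M₀` odd -/

/-- The Newman exponent vector `r'_t = 3N c_t` with all of Newman's conditions (replica of the construction inside
`star_eisEightGlobal`). [cite: Stevens1982, §2.4–2.5 (PDF pp. 35–38)] -/
theorem exists_newmanVector (hodd : Odd N) (hadm : IsAdmissibleStabData N β) :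
    ∃ r' : ℕ → ℤ, (∀ t ∈ N.divisors, (r' t : ℚ) = 3 * N * stabCoeff N β t) ∧ NewmanCond N r' 0 := by
  obtain ⟨r, hr, hsum, h1, h2, hz⟩ := exists_exponentVector (N := N) (β := β) hodd hadm
  choose z hz1 hz2 using hz
  have hsq : IsSquare (∏ t ∈ N.divisors, t ^ (r t).natAbs) := by
    have e : ∏ t ∈ N.divisors, t ^ (r t).natAbs = (∏ t ∈ N.divisors, t ^ (z t).natAbs) ^ 3 := by
      rw [← Finset.prod_pow]
      refine Finset.prod_congr rfl fun t _ ↦ ?_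
      rw [hz1 t, Int.natAbs_mul, show (3 : ℤ).natAbs = 3 from rfl, mul_comm, pow_mul]
    rw [e]
    exact (isSquare_prod_pow_natAbs N β hodd hadm z hz2).pow 3
  exact ⟨r, hr, ⟨hsum, h1, h2, hsq⟩⟩

/-- `3N·φ_β(a b; c d) = Σ_t r'_t Φ(a, tb; c/t, d)` for `r'_t = 3N c_t`. [cite: Stevens1982, §2.5 (PDF p. 38)] -/
theorem three_mul_period_eq_sum {r' : ℕ → ℤ} (hr' : ∀ t ∈ N.divisors, (r' t : ℚ) = 3 * N * stabCoeff N β t)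
    (a b c d : ℤ) :
    3 * (N : ℚ) * stabEisensteinPeriod N β a b c d = ∑ t ∈ N.divisors, (r' t : ℚ) * rademacherPhi a (t * b) (c / t) d := by
  rw [stabEisensteinPeriod_eq, Finset.mul_sum]
  refine Finset.sum_congr rfl fun t ht ↦ ?_
  rw [hr' t ht]; ring

/-- **`N φ_β(γ) ∈ 8ℤ` for `γ ∈ Γ₀(N)` with `c > 0`** (log-period integrality of the Newman quotient `g_β`).
[cite: RademacherGrosswald1972, Ch. 4 A, eq. (60)] [cite: Stevens1982, §2.5 (PDF p. 38)] -/
theorem exists_period_eq_eight_mul_of_pos (hodd : Odd N) (hadm : IsAdmissibleStabData N β) {a b c d : ℤ}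
    (hdet : a * d - b * c = 1) (hc : 0 < c) (hNc : (N : ℤ) ∣ c) :
    ∃ m : ℤ, (N : ℚ) * stabEisensteinPeriod N β a b c d = 8 * m := by
  obtain ⟨r', hr', hnc⟩ := exists_newmanVector hodd hadm
  obtain ⟨n, hn⟩ := etaQuotient_logPeriod_mem_int N r' hnc hdet hc hNc
  refine ⟨n, ?_⟩
  rw [← three_mul_period_eq_sum hr', div_eq_iff (by norm_num : (24 : ℚ) ≠ 0)] at hn
  linarith


/-- `φ_β(γ) = 0` for `c = 0` (`Φ(a, tb; 0, d) = tb/d` and `Σ c_t t = 0`). [cite: RademacherGrosswald1972, Ch. 4 A, eq. (59)] -/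
theorem period_of_c_eq_zero (hN : N ≠ 0) (hadm : IsAdmissibleStabData N β) (a b d : ℤ) :
    stabEisensteinPeriod N β a b 0 d = 0 := by
  rw [stabEisensteinPeriod_eq]
  have : ∀ t ∈ N.divisors, stabCoeff N β t * rademacherPhi a (t * b) ((0 : ℤ) / t) d =
      ((b : ℚ) / d) * (stabCoeff N β t * t) := by
    intro t _
    rw [Int.zero_ediv, rademacherPhi_of_c_eq_zero]; push_cast; ring
  rw [Finset.sum_congr rfl this, ← Finset.mul_sum, sum_divisors_stabCoeff_mul_self_eq_zero hN hadm, mul_zero]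

/-- **`N φ_β(γ) ∈ 8ℤ` for every `γ ∈ Γ₀(N)`.** [cite: RademacherGrosswald1972, Ch. 4 A, eq. (60)] [cite: Stevens1982, §2.5] -/
theorem exists_period_eq_eight_mul (hodd : Odd N) (hadm : IsAdmissibleStabData N β) (γ : SL(2, ℤ))
    (hγ : γ ∈ Gamma0 N) :
    ∃ m : ℤ, (N : ℚ) * stabEisensteinPeriod N β (γ 0 0) (γ 0 1) (γ 1 0) (γ 1 1) = 8 * m := by
  have hN : N ≠ 0 := fun h ↦ by simp [h] at hodd
  have hNc : (N : ℤ) ∣ γ 1 0 := (ZMod.intCast_zmod_eq_zero_iff_dvd _ _).mp (Gamma0_mem.mp hγ)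
  have hdet : γ 0 0 * γ 1 1 - γ 0 1 * γ 1 0 = 1 := by
    have := Matrix.SpecialLinearGroup.det_coe γ
    rw [Matrix.det_fin_two] at this
    linear_combination this
  rcases lt_trichotomy 0 (γ 1 0) with hc | hc | hc
  · exact exists_period_eq_eight_mul_of_pos hodd hadm hdet hc hNc
  · refine ⟨0, ?_⟩
    rw [← hc, period_of_c_eq_zero hN hadm, mul_zero, Int.cast_zero, mul_zero]
  · obtain ⟨m, hm⟩ := exists_period_eq_eight_mul_of_pos hodd hadm (a := -γ 0 0) (b := -γ 0 1) (c := -γ 1 0)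
      (d := -γ 1 1) (by linear_combination hdet) (by linarith) (dvd_neg.mpr hNc)
    exact ⟨m, by rwa [CuspEvenness.stabEisensteinPeriod_neg_of_dvd hNc] at hm⟩

/-- The Bézout matrix of an odd `a` over `2^m` (odd `N`) as an element of `Γ₀(N)`. [cite: Stevens1982, §2.5 eq. (2.5.3)] -/
theorem exists_gamma0_gammaEntries (hodd : Odd N) (m : ℕ) {a : ℤ} (ha : Odd a) :
    ∃ γ : SL(2, ℤ), γ ∈ Gamma0 N ∧ γ 0 0 = Int.gcdA (2 ^ m : ℕ) (a * N) ∧ γ 0 1 = a ∧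
      γ 1 0 = -(N : ℤ) * Int.gcdB (2 ^ m : ℕ) (a * N) ∧ γ 1 1 = (2 ^ m : ℕ) := by
  have h2 : IsCoprime (2 : ℤ) (a * N) := by
    have hodd' : Odd (a * N) := ha.mul (by exact_mod_cast hodd)
    rw [Int.isCoprime_iff_gcd_eq_one]
    have h := Int.gcd_dvd_left 2 (a * N)
    rcases (Nat.dvd_prime Nat.prime_two).mp (by exact_mod_cast h) with h1 | h1
    · exact h1
    · exfalso
      have h2 : (2 : ℤ) ∣ a * N := by
        have := Int.gcd_dvd_right 2 (a * N); rw [h1] at this; exact_mod_cast this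
      exact Int.not_even_iff_odd.mpr hodd' (even_iff_two_dvd.mpr h2)
  have hcop : Int.gcd ((2 ^ m : ℕ) : ℤ) (a * N) = 1 := by
    rw [← Int.isCoprime_iff_gcd_eq_one]
    push_cast
    exact h2.pow_left
  have hbez : ((2 ^ m : ℕ) : ℤ) * Int.gcdA (2 ^ m : ℕ) (a * N) + a * N * Int.gcdB (2 ^ m : ℕ) (a * N) = 1 := by
    have h := Int.gcd_eq_gcd_ab ((2 ^ m : ℕ) : ℤ) (a * N)
    rw [hcop, Nat.cast_one] at h
    linear_combination -h
  refine ⟨⟨!![Int.gcdA (2 ^ m : ℕ) (a * N), a; -(N : ℤ) * Int.gcdB (2 ^ m : ℕ) (a * N), (2 ^ m : ℕ)], ?_⟩,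
    ?_, rfl, rfl, rfl, rfl⟩
  · rw [Matrix.det_fin_two_of]; linear_combination hbez
  · rw [Gamma0_mem]
    show (((-(N : ℤ) * Int.gcdB (2 ^ m : ℕ) (a * N) : ℤ)) : ZMod N) = 0
    rw [ZMod.intCast_zmod_eq_zero_iff_dvd]
    exact ⟨-Int.gcdB (2 ^ m : ℕ) (a * N), by ring⟩

/-- **THE ARITHMETIC INPUT OF K2a: `N g' = 8 M₀` with `M₀` odd** for any generator `g'` of the value group `φ_β(Γ₀(N)) = ℤ g'`.
[cite: Stevens1982, §2.5, §5.4] [cite: MazurTateTeitelbaum1986Invent, §I.10–I.13] -/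
theorem exists_odd_generator (hodd : Odd N) (hadm : IsAdmissibleStabData N β) (g' : ℚ)
    (hgen : ∀ x : ℚ, (∃ γ : Gamma0 N, stabEisensteinPeriod N β ((γ : SL(2, ℤ)) 0 0) ((γ : SL(2, ℤ)) 0 1)
      ((γ : SL(2, ℤ)) 1 0) ((γ : SL(2, ℤ)) 1 1) = x) ↔ ∃ n : ℤ, x = n * g') :
    ∃ M₀ : ℤ, Odd M₀ ∧ (N : ℚ) * g' = 8 * M₀ := by
  -- `g'` is a value
  obtain ⟨γ₁, hγ₁⟩ := (hgen g').mpr ⟨1, by rw [Int.cast_one, one_mul]⟩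
  obtain ⟨M₀, hM₀⟩ := exists_period_eq_eight_mul hodd hadm (γ₁ : SL(2, ℤ)) γ₁.2
  rw [hγ₁] at hM₀
  refine ⟨M₀, ?_, hM₀⟩
  -- a cusp difference of 2-adic norm exactly `8⁻¹`
  obtain ⟨m, a, hIn, hnorm⟩ := exists_inC_norm_stabEisCuspDiff_eq hodd hadm
  have ha : Odd a := by
    rcases hIn with ⟨_, h4, _, _⟩
    exact Int.odd_iff.mpr (by omega)
  obtain ⟨γa, hγa, ha00, ha01, ha10, ha11⟩ := exists_gamma0_gammaEntries hodd m ha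
  obtain ⟨γb, hγb, hb00, hb01, hb10, hb11⟩ := exists_gamma0_gammaEntries hodd m (a := 1) odd_one
  obtain ⟨n₁, hn₁⟩ := (hgen _).mp ⟨⟨γa, hγa⟩, rfl⟩
  obtain ⟨n₂, hn₂⟩ := (hgen _).mp ⟨⟨γb, hγb⟩, rfl⟩
  have hdiff : stabEisCuspDiff N β m a = (n₁ - n₂ : ℤ) * g' := by
    simp only [stabEisCuspDiff, gammaEntries, one_mul]
    simp only at hn₁ hn₂
    rw [ha00, ha01, ha10, ha11] at hn₁
    rw [hb00, hb01, hb10, hb11] at hn₂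
    simp only [one_mul] at hn₂
    rw [hn₁, hn₂]; push_cast; ring
  -- norms: `‖(n₁ − n₂) g'‖₂ = 8⁻¹`, `N g' = 8 M₀`, `‖N‖₂ = 1` ⇒ `‖(n₁ − n₂) M₀‖₂ = 1` ⇒ `M₀` odd
  have hN0 : (N : ℚ) ≠ 0 := by exact_mod_cast (fun h ↦ by simp [h] at hodd : N ≠ 0)
  have hg' : g' = 8 * M₀ / N := by rw [eq_div_iff hN0, mul_comm]; exact hM₀
  rw [hdiff, hg'] at hnorm
  have hNnorm : ‖((N : ℚ) : ℚ_[2])‖ = 1 := by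
    rw [show ((N : ℚ) : ℚ_[2]) = ((N : ℤ) : ℚ_[2]) by push_cast; rfl]
    refine le_antisymm (Padic.norm_int_le_one _) ?_
    by_contra hlt
    rw [not_le, Padic.norm_intCast_lt_one_iff] at hlt
    have : (2 : ℤ) ∣ (N : ℤ) := by exact_mod_cast hlt
    exact (Int.not_even_iff_odd.mpr (by exact_mod_cast hodd : Odd (N : ℤ))) (even_iff_two_dvd.mpr this)
  have hkey : ‖(((n₁ - n₂ : ℤ) * M₀ : ℤ) : ℚ_[2])‖ = 1 := by
    have e : ((((n₁ - n₂ : ℤ) : ℚ) * (8 * M₀ / N) : ℚ) : ℚ_[2]) =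
        ((2 : ℕ) : ℚ_[2]) ^ (3 : ℕ) * (((n₁ - n₂ : ℤ) * M₀ : ℤ) : ℚ_[2]) / ((N : ℚ) : ℚ_[2]) := by
      push_cast; ring
    rw [e, norm_div, norm_mul, hNnorm, div_one, Padic.norm_p_pow] at hnorm
    have h8 : ((2 : ℕ) : ℝ) ^ (-(3 : ℕ) : ℤ) = 8⁻¹ := by norm_num
    rw [h8] at hnorm
    have h8' : (8⁻¹ : ℝ) ≠ 0 := by norm_num
    calc ‖(((n₁ - n₂ : ℤ) * M₀ : ℤ) : ℚ_[2])‖ = 8⁻¹ * ‖(((n₁ - n₂ : ℤ) * M₀ : ℤ) : ℚ_[2])‖ / 8⁻¹ := by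
          field_simp
      _ = 1 := by rw [hnorm, div_self h8']
  by_contra hev
  rw [Int.not_odd_iff_even, even_iff_two_dvd] at hev
  have hlt : ‖(((n₁ - n₂ : ℤ) * M₀ : ℤ) : ℚ_[2])‖ < 1 := by
    rw [Padic.norm_intCast_lt_one_iff]
    exact_mod_cast (Dvd.dvd.mul_left hev _)
  rw [hkey] at hlt
  exact lt_irrefl _ hlt

end Summit.BirchSwinnertonDyer.BirchSwinnertonDyer.Theorems.DepletionAtTwo.KEta.EtaSign
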